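import Mathlib.Analysis.Analytic.Constructions
import Mathlib.Analysis.Analytic.Linear
import Mathlib.Analysis.Calculus.FDeriv.Add
import Mathlib.Analysis.Calculus.FDeriv.Analytic
import Mathlib.Analysis.Calculus.FDeriv.Comp
import Literature.NumberTheory.Transcendental.KZCubicalCalculus
import Literature.NumberTheory.Transcendental.SemialgebraicLineDeriv
import HarnessLib

/-!
# `DilationTransfer` (stmt-KontsevichZagierPeriods-3572, route LiftingCriteria), line `birth`:
# stub `stub_sliceStokes` (S2b)

SLICING A PARAMETRIC STOKES FORM AT THE SPECIAL PARAMETER. Let `φ` be a function of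
`v ∈ [0,1]^D` and `a ∈ ℚ`. Suppose that on the slice `{w ∈ ℝ^{D+1} | init w ∈ [0,1]^D, w_D = a}`
the function `w ↦ φ (init w)` is a finite sum of Ayoub/Stokes elements
`∂_{c_k} H_k − H_k|_{z_{c_k}=1} + H_k|_{z_{c_k}=0}` (derivatives and restrictions in the first `D`
coordinates only, the last coordinate being a parameter), with `H_k` `ℚ`-semialgebraic and
real-analytic on an open set `W` containing the slice. Then `φ` is such a sum on `[0,1]^D` itself,
with the TAME data `H'_k := H_k ∘ e` on the open set `W' := e ⁻¹' W ⊇ [0,1]^D`, where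
`e v := Fin.snoc v a` is the affine slice embedding:

* `e = L + (0, …, 0, a)` with `L v = Fin.snoc v 0` linear, so `e` is continuous and analytic, `W'`
  is open, and `H'_k` is analytic on `W'` (composition);
* `H'_k` is `ℚ`-semialgebraic on `W'`: `e` is a polynomial map with rational coefficients
  (coordinates `X_i` and the constant `a`), so `W'` is semialgebraic (preimage) and `e` is a
  semialgebraic map on it; compose (Bochnak–Coste–Roy, Prop. 2.2.6);
* chain rule: `fderiv (H_k ∘ e) v (e_{c}) = fderiv H_k (e v) (L e_{c}) = fderiv H_k (e v) (e_{castSucc c})`;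
* restrictions: `e (update v c t) = update (e v) (castSucc c) t` (`Fin.snoc_update`).
-/

noncomputable section

open Set MvPolynomial

namespace Summit.KontsevichZagierPeriods.LiftingCriteria.DilationTransfer

open Literature.NumberTheory.Transcendental
open Literature.ModelTheory.ExponentialFields (IsSemialgebraic)

/-! ## The slice embedding `v ↦ (v, a)` is a rational polynomial map -/

/-- The coordinates of the slice embedding `v ↦ Fin.snoc v a` (`a ∈ ℚ`) are the values of the
rational polynomials `X_0, …, X_{D-1}, C a`. [folklore] -/
theorem sliceStokes_aeval_snoc (D : ℕ) (a : ℚ) (x : Fin D → ℝ) (j : Fin (D + 1)) :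
    aeval x ((Fin.snoc (fun i : Fin D => (X i : MvPolynomial (Fin D) ℚ)) (C a) :
      Fin (D + 1) → MvPolynomial (Fin D) ℚ) j) = (Fin.snoc x (a : ℝ) : Fin (D + 1) → ℝ) j := by
  refine Fin.lastCases ?_ (fun i => ?_) j
  · simp only [Fin.snoc_last, MvPolynomial.aeval_C, eq_ratCast]
  · simp only [Fin.snoc_castSucc, MvPolynomial.aeval_X]

/-- **Semialgebraic functions restrict to rational slices.** If `f` is `ℚ`-semialgebraic on
`W ⊆ ℝ^{D+1}` and `a ∈ ℚ`, then `v ↦ f (v, a)` is `ℚ`-semialgebraic on `{v | (v, a) ∈ W}`: the slice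
embedding is a polynomial map with rational coefficients, so the preimage of the (semialgebraic)
domain is semialgebraic and the embedding is a semialgebraic map on it; compose.
[cite: BochnakCosteRoy1998, Prop. 2.2.6] -/
theorem sliceStokes_isSemialgebraicFunOn_comp_snoc {D : ℕ} {W : Set (Fin (D + 1) → ℝ)}
    {f : (Fin (D + 1) → ℝ) → ℝ} (a : ℚ) (hf : IsSemialgebraicFunOn ℚ W f) :
    IsSemialgebraicFunOn ℚ
      ((fun v : Fin D → ℝ => (Fin.snoc v (a : ℝ) : Fin (D + 1) → ℝ)) ⁻¹' W)
      (fun v => f (Fin.snoc v (a : ℝ))) := by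
  have hW : IsSemialgebraic ℚ W := IsSemialgebraicFunOn.isSemialgebraic_holds hf
  set P : Fin (D + 1) → MvPolynomial (Fin D) ℚ :=
    Fin.snoc (fun i : Fin D => (X i : MvPolynomial (Fin D) ℚ)) (C a) with hP
  have he : (fun (x : Fin D → ℝ) (j : Fin (D + 1)) => aeval x (P j)) =
      fun v => (Fin.snoc v (a : ℝ) : Fin (D + 1) → ℝ) := by
    funext x j
    exact sliceStokes_aeval_snoc D a x j
  have hpre : IsSemialgebraic ℚ
      ((fun v : Fin D → ℝ => (Fin.snoc v (a : ℝ) : Fin (D + 1) → ℝ)) ⁻¹' W) := by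
    have h := hW.preimage_aeval (R := ℝ) P
    rwa [he] at h
  have hmap : IsSemialgebraicMapOn ℚ
      ((fun v : Fin D → ℝ => (Fin.snoc v (a : ℝ) : Fin (D + 1) → ℝ)) ⁻¹' W)
      (fun v : Fin D → ℝ => (Fin.snoc v (a : ℝ) : Fin (D + 1) → ℝ)) := by
    have h := isSemialgebraicMapOn_aeval hpre P
    rwa [he] at h
  exact IsSemialgebraicFunOn.comp_isSemialgebraicMapOn_holds hf hmap fun v hv => hv

/-! ## The linear part of the slice embedding -/

/-- The linear map `v ↦ Fin.snoc v 0` of `ℝ^D` into `ℝ^{D+1}` as a continuous linear map.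
[folklore] -/
theorem sliceStokes_exists_snocCLM (D : ℕ) :
    ∃ L : (Fin D → ℝ) →L[ℝ] (Fin (D + 1) → ℝ), ∀ v, L v = Fin.snoc v 0 :=
  ⟨ContinuousLinearMap.pi (Fin.snoc (α := fun _ => (Fin D → ℝ) →L[ℝ] ℝ)
      (fun i => ContinuousLinearMap.proj i) 0), fun v => by
    ext j
    refine Fin.lastCases ?_ (fun i => ?_) j
    · simp
    · simp⟩

/-- The slice embedding is its linear part plus the constant `(0, …, 0, a)`. [folklore] -/
theorem sliceStokes_snoc_eq_add {D : ℕ} {L : (Fin D → ℝ) →L[ℝ] (Fin (D + 1) → ℝ)}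
    (hL : ∀ v, L v = Fin.snoc v 0) (a : ℝ) (v : Fin D → ℝ) :
    (Fin.snoc v a : Fin (D + 1) → ℝ) = L v + Fin.snoc (0 : Fin D → ℝ) a := by
  ext j
  rw [Pi.add_apply, hL]
  refine Fin.lastCases ?_ (fun i => ?_) j
  · simp
  · simp

/-- The linear part of the slice embedding sends the basis vector `e_i` of `ℝ^D` to the basis
vector `e_{castSucc i}` of `ℝ^{D+1}`. [folklore] -/
theorem sliceStokes_snoc_single {D : ℕ} (i : Fin D) :
    (Fin.snoc (Pi.single i (1 : ℝ)) 0 : Fin (D + 1) → ℝ) = Pi.single (Fin.castSucc i) 1 := by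
  ext j
  refine Fin.lastCases ?_ (fun i' => ?_) j
  · simp [(Fin.castSucc_lt_last i).ne']
  · simp [Pi.single_apply, Fin.castSucc_inj]

/-! ## The stub -/

/-- **Stub S2b — slicing a parametric Stokes form at the special parameter.**
If a function `φ` of `v ∈ [0,1]^D`, read on the slice `{(v, a)}` of `ℝ^{D+1}` at a rational last
coordinate `a`, is there a finite sum of Ayoub elements `∂_{c_k} H_k − H_k|_{z_{c_k}=1} + H_k|_{z_{c_k}=0}`
(derivatives and restrictions in the first `D` coordinates only) with `H_k` `ℚ`-semialgebraic and
analytic on an open set containing the slice `[0,1]^D × {a}`, then `φ` itself is such a sum on `[0,1]^D`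
with the TAME data `H'_k(v) := H_k(v, a)` (analytic and `ℚ`-semialgebraic on the open set
`{v | (v, a) ∈ W} ⊇ [0,1]^D`; chain rule along the affine slice embedding `v ↦ Fin.snoc v a`,
`Function.update` commutes with `Fin.snoc` in the first coordinates). This is the specialisation step
`ϖ := ϖ₀` of the line (Newton–Leibniz data read in fewer variables).
[cite: KontsevichZagier2001, §1.2 rule (3)] -/
theorem stub_sliceStokes :
    ∀ (D : ℕ) (φ : (Fin D → ℝ) → ℝ) (a : ℚ) (K : ℕ) (c : Fin K → Fin D) (W : Set (Fin (D + 1) → ℝ)) (H : Fin K → (Fin (D + 1) → ℝ) → ℝ), IsOpen W → {w : Fin (D + 1) → ℝ | Fin.init w ∈ Literature.NumberTheory.Transcendental.KZ.cube D ∧ w (Fin.last D) = (a : ℝ)} ⊆ W → (∀ k, Literature.NumberTheory.Transcendental.IsSemialgebraicFunOn ℚ W (H k) ∧ AnalyticOnNhd ℝ (H k) W) → (∀ w : Fin (D + 1) → ℝ, Fin.init w ∈ Literature.NumberTheory.Transcendental.KZ.cube D → w (Fin.last D) = (a : ℝ) → φ (Fin.init w) = ∑ k, (fderiv ℝ (H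 k) w (Pi.single (Fin.castSucc (c k)) 1) - H k (Function.update w (Fin.castSucc (c k)) 1) + H k (Function.update w (Fin.castSucc (c k)) 0))) → ∃ (W' : Set (Fin D → ℝ)) (H' : Fin K → (Fin D → ℝ) → ℝ), IsOpen W' ∧ Literature.NumberTheory.Transcendental.KZ.cube D ⊆ W' ∧ (∀ k, Literature.NumberTheory.Transcendental.IsSemialgebraicFunOn ℚ W' (H' k) ∧ AnalyticOnNhd ℝ (H' k) W') ∧ ∀ v ∈ Literature.NumberTheory.Transcendental.KZ.cube D, φ v = ∑ k, (fderiv ℝ (H' k) v (Pi.single (c k) 1) - H' k (Function.update v (c k) 1) + H' k (Function.update v (c k) 0)) := by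
  intro D φ a K c W H hWo hWc hH hφ
  -- the slice embedding `e v = (v, a)` and its linear part `L v = (v, 0)`
  obtain ⟨L, hL⟩ := sliceStokes_exists_snocCLM D
  have he : (fun v : Fin D → ℝ => (Fin.snoc v (a : ℝ) : Fin (D + 1) → ℝ)) =
      fun v => L v + Fin.snoc (0 : Fin D → ℝ) (a : ℝ) :=
    funext fun v => sliceStokes_snoc_eq_add hL (a : ℝ) v
  have hde : ∀ v : Fin D → ℝ,
      HasFDerivAt (fun v : Fin D → ℝ => (Fin.snoc v (a : ℝ) : Fin (D + 1) → ℝ)) L v := fun v => by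
    rw [he]
    exact L.hasFDerivAt.add_const _
  have hea : ∀ v : Fin D → ℝ,
      AnalyticAt ℝ (fun v : Fin D → ℝ => (Fin.snoc v (a : ℝ) : Fin (D + 1) → ℝ)) v := fun v => by
    rw [he]
    exact (L.analyticAt v).add analyticAt_const
  have hec : Continuous (fun v : Fin D → ℝ => (Fin.snoc v (a : ℝ) : Fin (D + 1) → ℝ)) := by
    rw [he]
    exact L.continuous.add continuous_const
  -- `e` maps the cube into the slice, hence into `W`
  have hmem : ∀ v ∈ KZ.cube D, (Fin.snoc v (a : ℝ) : Fin (D + 1) → ℝ) ∈ W := fun v hv =>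
    hWc ⟨by rw [Fin.init_snoc]; exact hv, Fin.snoc_last _ _⟩
  refine ⟨(fun v : Fin D → ℝ => (Fin.snoc v (a : ℝ) : Fin (D + 1) → ℝ)) ⁻¹' W,
    fun k v => H k (Fin.snoc v (a : ℝ)), hWo.preimage hec, fun v hv => hmem v hv,
    fun k => ⟨sliceStokes_isSemialgebraicFunOn_comp_snoc a (hH k).1, fun v hv => ?_⟩,
    fun v hv => ?_⟩
  · -- analyticity of `H k ∘ e` on `e ⁻¹' W`
    have h2 : AnalyticAt ℝ (fun v : Fin D → ℝ => H k (Fin.snoc v (a : ℝ))) v :=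
      ((hH k).2 _ hv).comp_of_eq (hea v) rfl
    exact h2
  · -- the Stokes form on the slice, read at `w := e v`
    have h := hφ (Fin.snoc v (a : ℝ)) (by rw [Fin.init_snoc]; exact hv) (Fin.snoc_last _ _)
    rw [Fin.init_snoc] at h
    rw [h]
    refine Finset.sum_congr rfl fun k _ => ?_
    have hcomp : HasFDerivAt (fun v : Fin D → ℝ => H k (Fin.snoc v (a : ℝ)))
        ((fderiv ℝ (H k) (Fin.snoc v (a : ℝ))).comp L) v :=
      ((hH k).2 _ (hmem v hv)).differentiableAt.hasFDerivAt.comp v (hde v)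
    rw [hcomp.fderiv, ContinuousLinearMap.comp_apply, hL, sliceStokes_snoc_single]
    simp only [Fin.snoc_update]

end Summit.KontsevichZagierPeriods.LiftingCriteria.DilationTransfer
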